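import Literature.MathematicalPhysics.QuantumFieldTheory.Balaban1983to89.B11Eq98V0CurrentBackgroundModulus
import Literature.MathematicalPhysics.QuantumFieldTheory.Balaban1983to89.B11Eq98V0LettersLatticeUniform

/-!
# `Balaban1983to89.B11Eq98V0CurrentBackgroundModulusLatticeUniform` — T. Bałaban, *The variational problem and background fields in renormalization group method for lattice
# gauge theories*, Commun. Math. Phys. **102** (1985) 277–309 [Balaban1985Variational] (90)–(96) pp. 291–292, Prop. 4 (97)–(98) p. 293, (115) p. 294; [Balaban1985BackgroundPropagators]
# (3.35)–(3.36) p. 396: **THE V₀-GROUP'S TWO-BACKGROUND MODULUS `δ_V` IS LATTICE-FREE IN THE TOWER's CURRENCY** — ne9-leaf-05's `B11Eq98V0CurrentBackgroundModulus.curV0_background_modulus_flat`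
# bounds `‖curV0 ρ τ U Y − curV0 ρ τ 1 (ιY)‖₍₋₃₎ ≤ 524288e⁴(d−1)Λ²L^{j_M}‖ρ‖‖τ‖R_V²·ε` at a FIXED lattice (`L^{j_M}` the top level); on the tower the background window is
# `ε = αη` and `L^{j_M}·η = w̄₀ ≤ ω` (the displayed weight-profile letter), the level-geometry letter is `Λ := ωΩ` (leaf-05's `B11Eq98V0LettersLatticeUniform.levelGeometry_of_weight_bounds`):
# `‖curV0 ρ τ U Y − curV0 ρ τ 1 (ιY)‖₍₋₃₎ ≤ 524288e⁴(d−1)(ωΩ)²ω‖ρ‖‖τ‖R_V²·α` — NO top level, NO `η`: the letter `δ_V` of this lineage's `B11Eq98W80TwoBackgroundLetters` DISCHARGED on the model.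
# NE9 crux-team LEAF PROVER 01 (`b2b-balaban-t4-ne9-formalise-leaf-01`), gen 105; cell `pub-balaban`∕`t4`, row NE9, bears_on R4/N22; composition BY NAME; [folklore].
# WHAT IS PROVED (sorry-free; 0 `def`): `pow_topLevel_mul_eta_le` (`L^{max lev₀}·η ≤ w̄₀`), **`curV0_background_modulus_flat_latticeUniform`**.  HONEST SCOPE: bookkeeping over a LANDED
# bound; crude constants; unit-ball backgrounds, the plaquette window is NOT used (the bound is linear in the bond window `α`); «NE9 ⇐ the named binders»; NE9 NOT PRINTED ∕ NOT PROVED;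
# spine PROVED 0∕9; rung (B)+1 finite T⁴ — NOT infinite volume, NOT mass gap, NOT BetaPertH, NOT Clay.  HONEST DEPENDENCY: continuum YM on T⁴ ⇐ BetaPertH ∧ nine spine estimates
# (0/9 proved); BetaPertH ⇐ (D1) ∧ (D4) ∧ CAP+tail; G-an2-4 gates asym, D1 and NE2/3/4.

statement-level skeleton of published theorems with citation tags; proofs where landed; nothing here is a claim about the Yang–Mills mass gap
-/

noncomputable section

open NormedSpace Complex Metric Set Finset Filter Topology

namespace Literature.MathematicalPhysics.QuantumFieldTheory.Balaban1983to89.B11Eq98V0CurrentBackgroundModulusLatticeUniform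

open Literature.MathematicalPhysics.QuantumFieldTheory.Balaban1983to89.B9Eq39Adjoint (posPlaq)
open Literature.MathematicalPhysics.QuantumFieldTheory.Balaban1983to89.B11Eq90StB (st)
open Literature.MathematicalPhysics.QuantumFieldTheory.Balaban1983to89.B11Eq90V0primeBond (plaqWeight)
open Literature.MathematicalPhysics.QuantumFieldTheory.Balaban1983to89.B11Eq90V0primeCurrent (Tsh Ucur)
open Literature.MathematicalPhysics.QuantumFieldTheory.Balaban1983to89.B11Eq63V0GroupCurrent (curV0)
open Literature.MathematicalPhysics.QuantumFieldTheory.Balaban1983to89.B11Eq98V0CurrentBackgroundModulus (curV0_background_modulus_flat)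
open Literature.MathematicalPhysics.QuantumFieldTheory.Balaban1983to89.B11Eq98V0LettersLatticeUniform (levelGeometry_of_weight_bounds)
open B7Prop1Explicit (U1 mem_U1)
open B9SectCLatticeCarrier (Bond) open B4Sect5Torus (TSite)
open B11Eq115Space
open B11Eq111FrakG (jetLinearEquiv)

variable {𝔸 : Type*} [NormedRing 𝔸] [NormedAlgebra ℂ 𝔸] [CompleteSpace 𝔸] [NormOneClass 𝔸] [FiniteDimensional ℂ 𝔸]
variable {d : ℕ} {Pd : Fin d → ℕ} {L η : ℝ} [Fact (0 < L)] [Fact (0 < η)] {lev₀ : Bond d Pd → ℕ}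
  {κ' : Type*} [Fintype κ'] {lev₁ : κ' → ℕ}

omit [Fintype κ'] in
/-- **`L^{max_b lev₀ b}·η ≤ w̄₀`**: the top-level weight IS one of the weights (finite lattice, `1 ≤ d` so there is a bond), hence below the profile supremum `wSup`.
[folklore] [cite: Balaban1985Variational, (115) p.294] -/
theorem pow_topLevel_mul_eta_le (hd : 1 ≤ d) [∀ i, NeZero (Pd i)] :
    L ^ (Finset.univ.sup lev₀) * η ≤ (NegSup.wSup (levWeight L η lev₀ 1) : ℝ) := by
  classical
  have hne : (Finset.univ : Finset (Bond d Pd)).Nonempty := ⟨(fun i => ⟨0, Nat.pos_of_ne_zero (NeZero.ne _)⟩, ⟨0, hd⟩), Finset.mem_univ _⟩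
  obtain ⟨b, -, hb⟩ := Finset.exists_mem_eq_sup (Finset.univ : Finset (Bond d Pd)) hne lev₀
  rw [hb]
  have e : L ^ lev₀ b * η = levWeight L η lev₀ 1 b := by rw [levWeight_apply, pow_one]
  rw [e]
  exact NegSup.le_wSup (w := levWeight L η lev₀ 1) b

/-- **THE V₀-GROUP'S TWO-BACKGROUND MODULUS AT THE FLAT POINT, LATTICE-FREE** — see the module docstring: for a `U1`-valued background `U` with the bond window
`‖U(b) − 1‖ ≤ αη`, weight-profile bounds `w̄₀ ≤ ω`, `w̲₀,₁⁻¹, w̲₁,₂⁻¹ ≤ Ω` (`1 ≤ ω, Ω`) and `0 < R_V ≤ 1∕16`: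
`∀ Y, ‖Y‖ < R_V → ‖curV0 ρ τ U Y − curV0 ρ τ 1 (ιY)‖₍₋₃₎ ≤ (524288e⁴(d−1)(ωΩ)²‖ρ‖‖τ‖R_V²·ω)·α`. [folklore]
[cite: Balaban1985Variational, (90)–(96) pp.291–292, (98) p.293, (115) p.294; Balaban1985BackgroundPropagators, (3.35) p.396] -/
theorem curV0_background_modulus_flat_latticeUniform (hd : 1 ≤ d) [∀ i, NeZero (Pd i)] {Dc₁ Dc₂ : (Bond d Pd → 𝔸) →ₗ[ℂ] (κ' → 𝔸)}
    (lev₁' : Bond d Pd × Fin d → ℕ)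
    (ρ : (𝔸 →L[ℂ] ℂ) →L[ℂ] 𝔸) (τ : 𝔸 →L[ℂ] ℂ) (U : Bond d Pd → 𝔸ˣ) (hUb : ∀ b, U b ∈ U1 𝔸)
    {α : ℝ} (hα : 0 ≤ α) (hUη : ∀ b, ‖(U b : 𝔸) - 1‖ ≤ α * η) (hL : 1 ≤ L)
    {ω Ω : ℝ} (hω1 : 1 ≤ ω) (hΩ1 : 1 ≤ Ω) (hω : (NegSup.wSup (levWeight L η lev₀ 1) : ℝ) ≤ ω)
    (hΩ₀ : (NegSup.wInvSup (levWeight L η lev₀ 1) : ℝ) ≤ Ω) (hΩ₁ : (NegSup.wInvSup (levWeight L η lev₁' 2) : ℝ) ≤ Ω)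
    {RV : ℝ} (hRV : 0 < RV) (hRV' : RV ≤ 1 / 16) :
    ∀ Y : Space115 L η lev₀ lev₁ Dc₁, ‖Y‖ < RV →
      ‖curV0 (lev₁ := lev₁) (Dc := Dc₁) ρ τ U Y - curV0 (lev₁ := lev₁) (Dc := Dc₂) ρ τ (fun _ : Bond d Pd => (1 : 𝔸ˣ))
          ((LinearMap.toContinuousLinearMap ((jetLinearEquiv L η lev₀ lev₁ Dc₂).symm.toLinearMap ∘ₗ (jetLinearEquiv L η lev₀ lev₁ Dc₁).toLinearMap)) Y)‖
        ≤ (524288 * Real.exp 4 * ((d - 1 : ℕ) : ℝ) * (ω * Ω) ^ 2 * ‖ρ‖ * ‖τ‖ * RV ^ 2 * ω) * α := by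
  intro Y hY
  have hη : (0 : ℝ) < η := Fact.out
  have hUn : ∀ b, ‖(U b : 𝔸)‖ ≤ 1 ∧ ‖(((U b)⁻¹ : 𝔸ˣ) : 𝔸)‖ ≤ 1 := fun b => mem_U1.1 (hUb b)
  obtain ⟨-, hΛ, -, -⟩ := levelGeometry_of_weight_bounds (L := L) (η := η) lev₀ lev₁' hω1 hΩ1 hω hΩ₀ hΩ₁
  have h := curV0_background_modulus_flat (lev₁ := lev₁) (Dc₁ := Dc₁) (Dc₂ := Dc₂) ρ τ U hUn (mul_nonneg hα hη.le) hUη hL hΛ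
    (fun b => Finset.le_sup (Finset.mem_univ b)) hRV hRV' Y hY
  refine h.trans ?_
  have htop : L ^ (Finset.univ.sup lev₀) * η ≤ ω := (pow_topLevel_mul_eta_le (L := L) (η := η) (lev₀ := lev₀) hd).trans hω
  have hK : 0 ≤ 524288 * Real.exp 4 * ((d - 1 : ℕ) : ℝ) * (ω * Ω) ^ 2 * ‖ρ‖ * ‖τ‖ * RV ^ 2 := by positivity
  calc 524288 * Real.exp 4 * ((d - 1 : ℕ) : ℝ) * (ω * Ω) ^ 2 * L ^ (Finset.univ.sup lev₀) * ‖ρ‖ * ‖τ‖ * RV ^ 2 * (α * η)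
      = 524288 * Real.exp 4 * ((d - 1 : ℕ) : ℝ) * (ω * Ω) ^ 2 * ‖ρ‖ * ‖τ‖ * RV ^ 2 * (L ^ (Finset.univ.sup lev₀) * η) * α := by ring
    _ ≤ 524288 * Real.exp 4 * ((d - 1 : ℕ) : ℝ) * (ω * Ω) ^ 2 * ‖ρ‖ * ‖τ‖ * RV ^ 2 * ω * α := by
        exact mul_le_mul_of_nonneg_right (mul_le_mul_of_nonneg_left htop hK) hα

end Literature.MathematicalPhysics.QuantumFieldTheory.Balaban1983to89.B11Eq98V0CurrentBackgroundModulusLatticeUniform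

end
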